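import Summits.HodgeConjecture.HodgeConjecture.Theorems.Ring2MotivProductCells
import Literature.AlgebraicGeometry.HodgeTheory.MurtyTotallyRealMaximalSubfieldHodgeClasses
import HarnessLib

/-!
# Ring 2, route `motiv` — the MURTY-TYPE PRODUCT CELLS `A^{N+1} × C`, `C` of CM type

HONEST FRAMING (cell `pub-hodge-ring2`): research route conditional on HC_CM; not a corollary;
Q11.4-sentence-2 already refuted in dim ≥ 3. No transport is used here.

Murty 1988, Thm. 2 is in the tree as the NAMED FACT
`Murty1988_hodgeClasses_divisorial_powers_totallyRealMaxSubfield_oddHalfRank` (lit lane, atlas-2 gen 18,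
`Literature/AlgebraicGeometry/HodgeTheory/MurtyTotallyRealMaximalSubfieldHodgeClasses.lean`): if `End⁰(A)` contains a
totally real number field `K` equal to its own commutant with `dim A = [K:ℚ]·m`, `m` odd, then `B(A^{N+1}) = D(A^{N+1})`
for every `N`, whence (Lefschetz `(1,1)`, the tree's `hodgeConjectureFor_of_isDivisorGenerated`) the Hodge conjecture for
every power — `hodgeConjectureFor_powSucc_of_hasTotallyRealOddMaxSubfield`, NO `HC_CM`. Those POWER rows are the
Literature file's and atlas-2's (`Ring2.Atlas.…_of_murty1988`); this file does not restate them.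

This file files the ONE thing left to route `motiv` (RING2-MAP `## §motiv (gen 27)` M27.5 (β), second half; atlas-2
INBOX 2026-08-20T08:33Z (1)): the PRODUCT CELLS of the frame `Theorems/Ring2MotivProductCells.lean`
(`ProdCMCell 𝒜 𝒞 X := ∃ A C, X ~ A × C ∧ 𝒜 A ∧ IsOfCMType C ∧ 𝒞 C`) on the left class

  `𝒜_Mu B := (∃ A N, HasTotallyRealOddMaxSubfield A ∧ B ~ A^{N+1}) ∧ HasNoTypeIVFactor B`

— powers of Murty-type abelian varieties, with the splitting hypothesis `HasNoTypeIVFactor` KEPT EXPLICIT (in print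
it is automatic: a self-commutant subfield contains the centre of `End⁰(A)`, so every simple factor has totally real
centre, types I–III [Murty1988, §2 p. 62 with Thm. 2]; on the tree's carriers that inference is not available, and
nothing here asserts it). Rows, each ONE instance of a `Ring2MotivProductCells` row with HC on `𝒜_Mu` supplied by
Murty's fact:
* §1 KIND = LOAD-BEARING (route P): `HC_CM → Lombardo → Murty → HC(ProdCMCell 𝒜_Mu 𝒞)` for every `𝒞` — `HC_CM`
  (`Theses.RankFourFaces.CMAbelianHodge`, item stmt-HodgeConjecture-3052, a HYPOTHESIS by name) used once per
  member, at the CM factor; and the strict-product spelling `HC((A^{N+1}) × C)` on a Murty packet `(K, φ, m)`.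
* §2 KIND = ABSENT (refereed inputs only, no `HC_CM`): `𝒞 = (dim ≤ 3)` and `𝒞 = IsDivisorGenerated`.
* §3 EXACTNESS: modulo Murty's fact and Lombardo's, on the full cell (`𝒞 = ⊤`, one member on each side)
  `HC(ProdCMCell 𝒜_Mu ⊤) ↔ HC_CM` — these cells are worth EXACTLY `HC_CM`, no less.
* §4 ON PATH: every cell from `HC_AV` (item stmt-HodgeConjecture-1333) and from the summit statement.
Content in the atlas (`g ≤ 7`): left factors `A^{N+1}` with `A` of type II and a real-quadratic self-commutant
subfield (`g6.II(1)`-shaped, `m = 3`) or a totally real sextic one (`g6.II(3)`, `m = 1`), and every type-I `m`-odd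
row, times a CM factor; what is NOT here: left factors with a type-IV simple factor (the cell's splitting
hypothesis fails in general: Part IV's boundary fact `MoonenZarhin1999_exists_typeIV_threefold_prod_cmCurve_not_productSpan`).

THEOREMS ONLY; no `def`, no new named fact, no `sorry`; `HC_CM` and the two printed facts are binders wherever they
occur. References (bib keys): Murty1988 (Thm. 2, §1 Remark 1, §2), Lombardo2016 (Lemma 3.4), MoonenZarhin1999LowDim
(§3 (3.1)), Milne1999 (§7 (H)), Deligne2000 (§1), Fulton1998 (Example 10.1.2), vanGeemen1994HodgeAV (Lemma 3.7).
-/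

set_option linter.dupNamespace false

namespace Summit.HodgeConjecture.HodgeConjecture.Ring2.Motiv

open CategoryTheory
open Literature.AlgebraicGeometry Literature.AlgebraicGeometry.Motives
open Literature.AlgebraicGeometry.HodgeTheory
open Literature.AlgebraicGeometry.Milne1999
open Summit.HodgeConjecture.HodgeConjecture.Theses

variable {𝒞 : AbelianVariety ℂ → Prop}

/-! ## §0 HC on the left class, modulo Murty's fact (the Literature row, made isogeny-closed) -/

/-- **HC on the Murty-type power class**, modulo the fact: every `B ~ A^{N+1}` with `HasTotallyRealOddMaxSubfield A`
satisfies the Hodge conjecture (the Literature row `hodgeConjectureFor_powSucc_of_hasTotallyRealOddMaxSubfield`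
transported along the isogeny; no `HC_CM`). The conjunct `HasNoTypeIVFactor B` is not used here — it is the
splitting hypothesis of the product rows below. [cite: Murty1988, Thm. 2 and §1 Remark 1] -/
theorem hodgeConjectureFor_of_murtyTypePow_noTypeIV_of_murty1988
    (hM : Murty1988_hodgeClasses_divisorial_powers_totallyRealMaxSubfield_oddHalfRank)
    (B : AbelianVariety ℂ)
    (hB : (∃ (A : AbelianVariety ℂ) (N : ℕ), HasTotallyRealOddMaxSubfield A ∧
      AbelianVariety.IsIsogenous B (A.powSucc N)) ∧ HasNoTypeIVFactor B) :
    HodgeConjectureFor B.dim B.X := by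
  obtain ⟨A, N, hA, hBi⟩ := hB.1
  exact HodgeConjectureFor.of_isIsogenous hBi (hodgeConjectureFor_powSucc_of_hasTotallyRealOddMaxSubfield hM hA N)

/-! ## §1 KIND = LOAD-BEARING (route P): arbitrary CM factor, `HC_CM` by name -/

/-- **ROW (route P): HC on the Murty-type product cells from `HC_CM`.** For every `X ~ B × C` with `B ~ A^{N+1}`,
`End⁰(A) ⊇ K` a totally real self-commutant subfield of odd co-rank, `B` without type-IV factor, and `C` of CM type
(any dimension, any `𝒞`): the Hodge conjecture holds for `X`, from `HC_CM` (binder `hCM`, item stmt-HodgeConjecture-3052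
by name, used once — at `C`), Lombardo's span fact (binder `hL`) and Murty's theorem (binder `hM`). An instance of
`hodgeConjectureFor_of_prodCMCell_noTypeIV_of_cmAbelianHodge_of_lombardo`.
[cite: Murty1988, Thm. 2] [cite: Lombardo2016, Lemma 3.4 (p. 1229)] [cite: Milne1999, §7 (H)] -/
theorem hodgeConjectureFor_of_prodCMCell_murtyTypePow_noTypeIV_of_cmAbelianHodge
    (hCM : RankFourFaces.CMAbelianHodge) (hL : Lombardo2016_hodgeClassesProductSpan)
    (hM : Murty1988_hodgeClasses_divisorial_powers_totallyRealMaxSubfield_oddHalfRank)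
    {X : AbelianVariety ℂ}
    (hX : ProdCMCell (fun B ↦ (∃ (A : AbelianVariety ℂ) (N : ℕ), HasTotallyRealOddMaxSubfield A ∧
      AbelianVariety.IsIsogenous B (A.powSucc N)) ∧ HasNoTypeIVFactor B) 𝒞 X) :
    HodgeConjectureFor X.dim X.X :=
  hodgeConjectureFor_of_prodCMCell_noTypeIV_of_cmAbelianHodge_of_lombardo hCM hL
    (fun B hB ↦ hodgeConjectureFor_of_murtyTypePow_noTypeIV_of_murty1988 hM B hB) hX

/-- **The strict-product spelling on a Murty packet**: for `IsMurtyTypeWith A K φ m`, every `N`, every CM `C`,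
`HC_CM → Lombardo → Murty → HasNoTypeIVFactor (A^{N+1}) → HC(A^{N+1} × C)` — Part I's frame
`hodgeConjectureFor_prod_of_cmHodgeHypothesis` with HC of the left factor supplied by Murty's theorem
(`hodgeConjectureFor_powSucc_of_isMurtyTypeWith`). `HC_CM` unfolds to Milne's per-variety form by `Iff.rfl`.
[cite: Murty1988, Thm. 2] [cite: Lombardo2016, Lemma 3.4 (p. 1229)] [cite: Milne1999, §7 (H)] -/
theorem hodgeConjectureFor_powSucc_prod_of_isMurtyTypeWith_of_cmAbelianHodge
    (hCM : RankFourFaces.CMAbelianHodge) (hL : Lombardo2016_hodgeClassesProductSpan)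
    (hM : Murty1988_hodgeClasses_divisorial_powers_totallyRealMaxSubfield_oddHalfRank)
    {K : Type} [Field K] [NumberField K] {A : AbelianVariety ℂ} {φ : K →+* A.endAlgebra} {m : ℕ}
    (hA : IsMurtyTypeWith A K φ m) (N : ℕ) (h4 : HasNoTypeIVFactor (A.powSucc N))
    (C : AbelianVariety ℂ) (hCt : IsOfCMType C) :
    HodgeConjectureFor ((A.powSucc N).prod C).dim ((A.powSucc N).prod C).X :=
  hodgeConjectureFor_prod_of_cmHodgeHypothesis (fun B ↦ hCM B) hL (A.powSucc N) C h4 hCt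
    (hodgeConjectureFor_powSucc_of_isMurtyTypeWith hM hA N)

/-! ## §2 KIND = ABSENT: refereed inputs only, no `HC_CM` -/

/-- **ROW (no `HC_CM`): CM factor of dimension `≤ 3`.** `Lombardo → Murty → HC(ProdCMCell 𝒜_Mu (dim ≤ 3))`: HC of
the CM factor is the tree's unconditional `dim ≤ 3` theorem. [cite: Murty1988, Thm. 2]
[cite: Lombardo2016, Lemma 3.4 (p. 1229)] [cite: MoonenZarhin1999LowDim, Introduction and §3] -/
theorem hodgeConjectureFor_of_prodCMCell_murtyTypePow_noTypeIV_cm_dim_le_three_of_lombardo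
    (hL : Lombardo2016_hodgeClassesProductSpan)
    (hM : Murty1988_hodgeClasses_divisorial_powers_totallyRealMaxSubfield_oddHalfRank)
    {X : AbelianVariety ℂ}
    (hX : ProdCMCell (fun B ↦ (∃ (A : AbelianVariety ℂ) (N : ℕ), HasTotallyRealOddMaxSubfield A ∧
      AbelianVariety.IsIsogenous B (A.powSucc N)) ∧ HasNoTypeIVFactor B) (fun C ↦ C.dim ≤ 3) X) :
    HodgeConjectureFor X.dim X.X :=
  hodgeConjectureFor_of_prodCMCell_noTypeIV_cm_dim_le_three_of_lombardo hL
    (fun B hB ↦ hodgeConjectureFor_of_murtyTypePow_noTypeIV_of_murty1988 hM B hB) hX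

/-- **ROW (no `HC_CM`): CM factor with divisor-generated Hodge ring** (e.g. a power of a CM elliptic curve, a simple
CM abelian variety of prime dimension): `Lombardo → Murty → HC(ProdCMCell 𝒜_Mu IsDivisorGenerated)`.
[cite: Murty1988, Thm. 2] [cite: Lombardo2016, Lemma 3.4 (p. 1229)] [cite: vanGeemen1994HodgeAV, Thm. 4.6] -/
theorem hodgeConjectureFor_of_prodCMCell_murtyTypePow_noTypeIV_cmDivisorGenerated_of_lombardo
    (hL : Lombardo2016_hodgeClassesProductSpan)
    (hM : Murty1988_hodgeClasses_divisorial_powers_totallyRealMaxSubfield_oddHalfRank)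
    {X : AbelianVariety ℂ}
    (hX : ProdCMCell (fun B ↦ (∃ (A : AbelianVariety ℂ) (N : ℕ), HasTotallyRealOddMaxSubfield A ∧
      AbelianVariety.IsIsogenous B (A.powSucc N)) ∧ HasNoTypeIVFactor B) IsDivisorGenerated X) :
    HodgeConjectureFor X.dim X.X :=
  hodgeConjectureFor_of_prodCMCell_isDivisorGenerated (cellProductSpan_of_lombardo hL fun _ hB ↦ hB.2)
    (fun B hB ↦ hodgeConjectureFor_of_murtyTypePow_noTypeIV_of_murty1988 hM B hB) hX

/-! ## §3 EXACTNESS: the full Murty-type product cell is worth exactly `HC_CM` -/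

/-- **EXACTNESS (modulo Murty and Lombardo).** On the full cell (`𝒞 = ⊤`), given one member of the left class and one
CM abelian variety, HC on the Murty-type product cells is EQUIVALENT to `HC_CM`: the left class costs nothing beyond
Murty's theorem, the CM side costs all of `HC_CM` (descent to the right factor, Part II
`hodgeConjectureFor_right_of_prod`). [cite: Murty1988, Thm. 2] [cite: Lombardo2016, Lemma 3.4 (p. 1229)]
[cite: Milne1999, §7 (H)] [cite: Fulton1998, §10.1 Example 10.1.2] -/
theorem forall_prodCMCell_murtyTypePow_noTypeIV_top_iff_cmAbelianHodge
    (hL : Lombardo2016_hodgeClassesProductSpan)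
    (hM : Murty1988_hodgeClasses_divisorial_powers_totallyRealMaxSubfield_oddHalfRank)
    (hA₀ : ∃ B : AbelianVariety ℂ, (∃ (A : AbelianVariety ℂ) (N : ℕ), HasTotallyRealOddMaxSubfield A ∧
      AbelianVariety.IsIsogenous B (A.powSucc N)) ∧ HasNoTypeIVFactor B)
    (hC₀ : ∃ C : AbelianVariety ℂ, IsOfCMType C) :
    (∀ X : AbelianVariety ℂ,
        ProdCMCell (fun B ↦ (∃ (A : AbelianVariety ℂ) (N : ℕ), HasTotallyRealOddMaxSubfield A ∧
          AbelianVariety.IsIsogenous B (A.powSucc N)) ∧ HasNoTypeIVFactor B) (fun _ ↦ True) X →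
        HodgeConjectureFor X.dim X.X) ↔ RankFourFaces.CMAbelianHodge := by
  rw [forall_prodCMCell_noTypeIV_top_iff_of_lombardo
    (𝒜 := fun B ↦ ∃ (A : AbelianVariety ℂ) (N : ℕ), HasTotallyRealOddMaxSubfield A ∧
      AbelianVariety.IsIsogenous B (A.powSucc N)) hL hA₀ hC₀]
  exact ⟨fun h ↦ h.2, fun h ↦ ⟨fun B hB ↦ hodgeConjectureFor_of_murtyTypePow_noTypeIV_of_murty1988 hM B hB, h⟩⟩

/-! ## §4 ON PATH (mandatory, free) -/

/-- **ON-PATH: `HC_AV → HC(cell)`** (item stmt-HodgeConjecture-1333 by name). [cite: Deligne2000, §1] -/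
theorem hodgeConjectureFor_of_prodCMCell_murtyTypePow_of_hodgeAbelianVarieties
    (h : PadicSemiregularLift.HodgeAbelianVarieties) {X : AbelianVariety ℂ}
    (hX : ProdCMCell (fun B ↦ (∃ (A : AbelianVariety ℂ) (N : ℕ), HasTotallyRealOddMaxSubfield A ∧
      AbelianVariety.IsIsogenous B (A.powSucc N)) ∧ HasNoTypeIVFactor B) 𝒞 X) :
    HodgeConjectureFor X.dim X.X :=
  hodgeConjectureFor_of_prodCMCell_of_hodgeAbelianVarieties h hX

/-- **ON-PATH: the summit statement `HodgeConjecture → HC(cell)`.** [cite: Deligne2000, §1] -/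
theorem hodgeConjectureFor_of_prodCMCell_murtyTypePow_of_hodgeConjecture
    (h : _root_.HodgeConjecture) {X : AbelianVariety ℂ}
    (hX : ProdCMCell (fun B ↦ (∃ (A : AbelianVariety ℂ) (N : ℕ), HasTotallyRealOddMaxSubfield A ∧
      AbelianVariety.IsIsogenous B (A.powSucc N)) ∧ HasNoTypeIVFactor B) 𝒞 X) :
    HodgeConjectureFor X.dim X.X :=
  hodgeConjectureFor_of_prodCMCell_of_hodgeConjecture h hX

end Summit.HodgeConjecture.HodgeConjecture.Ring2.Motiv
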